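import Summits.QuantumFields.YangMills.Theorems.BalabanUVNodesK0Stub1GridNumericsGuardWitness
import Summits.QuantumFields.YangMills.Theorems.BalabanUVNodesK0PrintCubeOfStepTokensGuarded

/-!
# K0⁷ — FILE 4‴: THE K0-BODY COMPOSITION UNDER THE CANDIDATE GRID-NUMERICS GUARD `A‴(c, c₀, c₁)` — PART 1 (body at an arbitrary cube letter, stub-level composition with a generic
# (9)-supplier, NODE O's socket) and PART 2 (stub 2′ fills the supplier; ★★★ the composition `stub 1-G‴ ∧ stub 2′ ∧ 3ᴬ′-G‴ ⟹ K0⁷'s body on every family`), plus the ANTITONE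
# bridges `stub 1-G ⟹ stub 1-G‴`, `3ᴬ′-G‴ ⟹ 3ᴬ′-G` — the binders `h1G‴` ∕ `h3A'G‴` a V21-G skeleton would copy VERBATIM (plan g86 «V21-G recipe of record», bus 2026-08-28 15:14:49Z)

Cell `pub-ymgap`, width seat `pub-ymgap-k0-s1-w3` generation 8 (K0⁷ `stmt-QuantumFields-20541`, V20-G stub 1 `stub_prop8StepCoPG13` helper lane;
`--kind proof --supports stmt-QuantumFields-20541 --as helper`).  NEW leaf, theorems only (0 `def`, 0 `sorry`); nothing in the tree is modified.  The `A‴` sibling of this seat's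
`…K0AllTorusOfStepTokensGuarded` §4 (p635083, PART 1-G) and `…K0PrintCubeOfStepTokensGuarded` (p635645, PART 2-G), exactly as those were the G siblings of the R files.
[15] = [Balaban1985Variational]; [6] = [Balaban1985RegularSpaces]; [III] = [Balaban1988Convergent]; [I] = [Balaban1987RG1].

WHY.  LOCATED-STUB1-GRID-NUMERICS (this seat, bus 15:11Z; kernel side `…K0Stub1GridNumericsGuardWitness`; lane owner dag-n07-e LOCATED-CANDIDATE 15:09Z; plan g86 ACK + «V21-G
RECIPE OF RECORD» 15:14:49Z): the registered V20-G guard `A(c, c₀) := fun ν _M _g K k _s => c ≤ ν.M₁ ∧ k + c₀ ≤ F.m + K` ignores the record's cube letter `M` and history `g`, so the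
grid numerics `hgran` ∕ `hdiv` displayed by road R0′'s record-side suppliers are underivable from the stub-1 prefix; the plan's recipe, IF the located defect is confirmed (author file ✓,
ONE referee read, director word), is the four-conjunct guard
`A‴(c, c₀, c₁) := fun ν M g K k _s => c ≤ ν.M₁ ∧ k + c₀ ≤ F.m + K ∧ F.L ^ c₁ ∣ M ∧ ∀ i, 1 ≤ i → i ≤ k → dCubeSide (F.P K).L M (RkOfRecord (F.P K).L ν.r (g i)) i ∣ (F.P K).sitesPerDir 0`
with `c c₀ c₁` ∃-bound OUTERMOST in stub 1-G‴ and binders `(j c c₀ c₁)`, riders `c₀ ≤ j + 1 ∧ c₁ ≤ j`, in stub 3ᴬ′-G‴; «THEN ORDER: k0-s1-w3 FILE 4‴ (guarded tokens with `A‴` + the antitone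
bridges; binders `h1G‴`∕`h3A′G‴`) LANDS → the plan seat registers K0⁷ V21-G copying those binders VERBATIM».  THIS IS THAT FILE, typed in advance so that the order is mechanical; it
registers nothing and keys on no unregistered DEFINITION (the guard is a lambda, as in p635083 ∕ p635645).
CONTENTS.  §1 PART 1-G‴ (p635083 §4 with `A‴` and the rider `c₁ ≤ j` threaded; the witness-level closer is `…K0Stub1GridNumericsGuardWitness`'s
`exists_k0SepCoPH_thm1CCMW_gridGuard_of_thm1RegSepCoP7MG_of_gauge9TopStepG_of_hcomp_allTorus`): ★ `exists_k0H_of_thm1CoP7MG3_of_gauge9G3_of_absBox` · ★★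
`record13SepCoPHBody_of_stub1G3_of_gauge9SupplierG3_of_absBetaBoxAtG3` · `absBetaBoxAtG3_of_jetsFreePairAtG3` (NODE O's socket on the G‴ text).  §2 PART 2-G‴ (p635645 §1–§2 with `A‴`;
dag-n07-e module 51 `gauge9GP_of_prop8TopStepG_of_prop6P_of_one_le` is guard-generic, the cube letter becomes `j := ρ₀ + 3 + c + c₀ + c₁` so that `c₁ ≤ j`): ★★ `gauge9SupplierG3_of_prop6MemberP` ·
★★★ `record13SepCoPHBody_of_stubs1G3_2P_3A'G3` (THE V21-G SKELETON COMPOSITION: `h1G3` = stub 1-G‴ text, `h2P` = stub 2′ VERBATIM (landed p595104), `h3A'G3` = 3ᴬ′-G‴ text).  §3 the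
directions (kernel): `prop8StepCoPG3_of_prop8StepCoPG` (stub 1: G ⟹ G‴ at `c₁ := 0`, the step token is ANTITONE in the guard — so every in-flight stub-1-G filing, e.g. k0-s1-w4's, stays
usable: `record13SepCoPHBody_of_stubs1G_2P_3A'G3`), `absBetaBoxAtGenG_of_absBetaBoxAtGenG3` (3ᴬ′: G‴ ⟹ G at `c₁ := 0` — G‴ is the STRONGEST 3ᴬ′ text, as G was over R).
HONEST FRAMING: count-neutral kernel re-keying BY NAME; every [15]∕[6]∕[I] sentence is a HYPOTHESIS (a `Prop`, never asserted, inhabited nowhere here); the compositions are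
CONDITIONAL on CANDIDATE texts the plan has NOT registered (V20-G dead8a8df885c226 stands); `stub_prop8StepCoPG13` ∕ K0⁷ ∕ K1⁹ NOT closed; N07 NOT discharged; counts unmoved
(typed 28∕28 · discharged 5∕27); the route closes only the conditional finite-𝕋⁴ rung `BalabanLadder.UV` — the YM mass gap (Clay) is NOT proved by any of this; nothing continuum ∕
ℝ⁴ ∕ OS.  No `sorry`, `def`, `instance`, `notation`.
-/

noncomputable section

open MeasureTheory
open scoped Matrix.Norms.L2Operator

namespace Summit.QuantumFields.YangMills.Theorems.K0PrintCubeOfStepTokensGridGuarded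

open Literature.MathematicalPhysics.QuantumFieldTheory.Balaban1983to89
open Literature.MathematicalPhysics.QuantumFieldTheory.Balaban1983to89.Node00
open Literature.MathematicalPhysics.QuantumFieldTheory.Balaban1983to89.T4Continuum
open Literature.MathematicalPhysics.QuantumFieldTheory.Balaban1983to89.FlowStep
open Literature.MathematicalPhysics.QuantumFieldTheory.Balaban1983to89.FlowStepRuns
open Literature.MathematicalPhysics.QuantumFieldTheory.Balaban1983to89.B8LeafModelZd (ZdIdx)
open Literature.MathematicalPhysics.QuantumFieldTheory.Balaban1983to89.Beta.Drift (OneLoopDrift)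
open Summit.QuantumFields.BalabanUV.Gaps.BetaContFromD4Chain (AtSlopeCont)
open Summit.QuantumFields.YangMills.BalabanUVNodes.N07Thm1Top7FromProp8 (variationalThm1RegSepCoP7MG_of_prop8TopStepG)
open Summit.QuantumFields.YangMills.Theorems.K0GenericCubeOfStepTokensR (clausesH_of_absBox)
open Summit.QuantumFields.YangMills.Theorems.BalabanUVNodesN26AtRecord13BetaBoxOfDriftAtSlope (exists_betaBox_betaOfRecord₁₃_of_jetsFreePair)
open Summit.QuantumFields.YangMills.Theorems.K0PrintCubeOfStepTokensRFloor (max_floor_le_pow)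
open Summit.QuantumFields.YangMills.Theorems.K0Stub1GridNumericsGuardWitness (exists_k0SepCoPH_thm1CCMW_gridGuard_of_thm1RegSepCoP7MG_of_gauge9TopStepG_of_hcomp_allTorus)

/-! ## §1  PART 1-G‴: the body at an arbitrary cube letter `(L^j, c, c₀, c₁)`, the stub-level composition with a GENERIC (9)-supplier, NODE O's socket — under `A‴` -/

section Part1GridGuarded

/-- **★ THE ⁷ K0 BODY FOR `F` AT AN ARBITRARY CUBE LETTER `(L^j, c, c₀, c₁)` WITH `c ≤ L^j`, `c₀ ≤ j + 1`, `c₁ ≤ j`, FROM THE (8)-SENTENCE AND THE (9)-TOKEN UNDER `A‴` AND ONE ABS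
β-BOX OF `θ₁₅ᶜᶜᴹ(j)`** — p635083 §4's `exists_k0H_of_thm1CoP7MG_of_gauge9G_of_absBox` under the candidate guard: `clausesH_of_absBox` (token-free) gives (hcomp) ∧ (hcompRev) at
`θ₁₅ᶜᶜᴹᵂ(j; γ)`, then `…K0Stub1GridNumericsGuardWitness` §3.  CONDITIONAL. [cite: Balaban1985Variational, Thm 1 (8)–(9) p.279, (144)–(152) pp.300–301, Prop. 8 p.304, p.304 lines 1–2; Balaban1988Convergent, Thm 1 p.262, (2.1) p.254, (2.5)–(2.8) pp.255–256, p.257, (2.21) p.258; Balaban1987RG1, Thm 1 p.259, (0.1) p.251, (1.12) p.262, §1 p.264] -/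
theorem exists_k0H_of_thm1CoP7MG3_of_gauge9G3_of_absBox (F : T4Family) {j c c₀ c₁ : ℕ} (hc : c ≤ F.L ^ j) (hc₀ : c₀ ≤ j + 1) (hc₁ : c₁ ≤ j) {B₃ B₉ a₀ a₁ : ℝ} (hB₃ : 0 ≤ B₃) (hB₉ : 0 ≤ B₉)
    (ha₀ : 0 < a₀) (ha₁ : 0 < a₁) (h15 : VariationalThm1RegSepCoP7MG F 2 (fun ν M g K k _s => c ≤ ν.M₁ ∧ k + c₀ ≤ F.m + K ∧ F.L ^ c₁ ∣ M ∧
      ∀ i, 1 ≤ i → i ≤ k → dCubeSide (F.P K).L M (RkOfRecord (F.P K).L ν.r (g i)) i ∣ (F.P K).sitesPerDir 0) B₃ a₀ a₁)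
    (h9 : Gauge9RegSepTopStepG F 2 (fun ν K Ω => suppDomOfRecord F ν K Ω) (F.L ^ j) (fun ν M g K k _s => c ≤ ν.M₁ ∧ k + c₀ ≤ F.m + K ∧ F.L ^ c₁ ∣ M ∧
      ∀ i, 1 ≤ i → i ≤ k → dCubeSide (F.P K).L M (RkOfRecord (F.P K).L ν.r (g i)) i ∣ (F.P K).sitesPerDir 0) B₃ B₉ a₀ a₁)
    (h3A : ∃ γ₀ ε₀ ε₂₉ β' : ℝ, 0 < γ₀ ∧ 0 < ε₀ ∧ 0 < ε₂₉ ∧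
        BetaLowerH (-β') γ₀ (betaOfRecord₁₃ F 2 (theta13OfThm1CCM F 2 j ε₀ ε₂₉ B₃ B₉ a₀ a₁)) ∧
        BetaUpperH β' γ₀ (betaOfRecord₁₃ F 2 (theta13OfThm1CCM F 2 j ε₀ ε₂₉ B₃ B₉ a₀ a₁))) :
    ∃ θ : Stage13HParams F 2, θ.Provisos₁₃SepCoPH F 2 ∧ (θ.ZhUnity F 2 ∧ θ.SlotsNondegenerate₁₃ F 2) ∧ θ.Admissible F 2 := by
  obtain ⟨γ, ε₀, ε₂₉, hγ0, hγ, hε, hε', hcomp, hcompRev⟩ := clausesH_of_absBox F j hB₃ hB₉ ha₀.le ha₁.le h3A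
  exact exists_k0SepCoPH_thm1CCMW_gridGuard_of_thm1RegSepCoP7MG_of_gauge9TopStepG_of_hcomp_allTorus F hγ0 hγ hε hε' hB₃ hB₉ ha₀ ha₁ hc hc₀ hc₁ h15 h9 hcomp hcompRev

/-- **★★ K0⁷'s BODY AT EVERY FAMILY FROM THE CANDIDATE STUB 1-G‴, A GENERIC (9)-SUPPLIER UNDER `A‴`, AND THE CANDIDATE 3ᴬ′-G‴** — p635083 §4's
`record13SepCoPHBody_of_stub1G_of_gauge9SupplierG_of_absBetaBoxAtG` with the guard `A‴(c, c₀, c₁)` and the rider `c₁ ≤ j` threaded (proof VERBATIM otherwise: stub 1 ⇒ the guarded (8)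
`CoP` sentence by module 53, ceiling shrunk by `.of_le`, guard refined `(c, c₀, c₁) → (c′, c₀, c₁)` by `.of_imp`; `hSG` ⇒ (9); `h3A'G` ⇒ the box ⇒ §1's first theorem).  CONDITIONAL; the
texts `h1G`∕`h3A'G` here are CANDIDATES (plan g86 «V21-G recipe of record», bus 15:14:49Z), NOT registered; K0⁷ NOT closed; nothing of Bałaban asserted.
[cite: Balaban1985Variational, Thm 1 (8)–(9) p.279, (144)–(152) pp.300–301, Prop. 8 p.304, p.304 lines 1–2; Balaban1985RegularSpaces, (1.3)–(1.6) p.77, Prop. 6 p.99; Balaban1988Convergent, Thm 1 p.262, (2.1) p.254, (2.5)–(2.8) pp.255–256, p.257; Balaban1987RG1, Thm 1 p.259, (0.1) p.251, §1 p.264] -/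
theorem record13SepCoPHBody_of_stub1G3_of_gauge9SupplierG3_of_absBetaBoxAtG3
    (h1G : ∀ F : T4Family, ∃ (c c₀ c₁ : ℕ) (B₃ a₀ a₁ : ℝ), 2 * (F.L : ℝ) ^ 2 ≤ B₃ ∧ 0 < a₀ ∧ 0 < a₁ ∧
      Prop8RegSepTopStepG F 2 (fun ν K Ω => suppDomOfRecord F ν K Ω) (fun ν M g K k _s => c ≤ ν.M₁ ∧ k + c₀ ≤ F.m + K ∧ F.L ^ c₁ ∣ M ∧
      ∀ i, 1 ≤ i → i ≤ k → dCubeSide (F.P K).L M (RkOfRecord (F.P K).L ν.r (g i)) i ∣ (F.P K).sitesPerDir 0) B₃ a₀ a₁)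
    (hSG : ∀ (F : T4Family) (c c₀ c₁ : ℕ) (B₃ a₀ a₁ : ℝ), 2 * (F.L : ℝ) ^ 2 ≤ B₃ → 0 < a₀ → 0 < a₁ →
      Prop8RegSepTopStepG F 2 (fun ν K Ω => suppDomOfRecord F ν K Ω) (fun ν M g K k _s => c ≤ ν.M₁ ∧ k + c₀ ≤ F.m + K ∧ F.L ^ c₁ ∣ M ∧
      ∀ i, 1 ≤ i → i ≤ k → dCubeSide (F.P K).L M (RkOfRecord (F.P K).L ν.r (g i)) i ∣ (F.P K).sitesPerDir 0) B₃ a₀ a₁ →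
      ∃ (j c' : ℕ) (B₉ a₁' : ℝ), c ≤ c' ∧ c' ≤ F.L ^ j ∧ c₀ ≤ j + 1 ∧ c₁ ≤ j ∧ 0 < B₉ ∧ 0 < a₁' ∧ a₁' ≤ a₁ ∧
        Gauge9RegSepTopStepG F 2 (fun ν K Ω => suppDomOfRecord F ν K Ω) (F.L ^ j) (fun ν M g K k _s => c' ≤ ν.M₁ ∧ k + c₀ ≤ F.m + K ∧ F.L ^ c₁ ∣ M ∧
      ∀ i, 1 ≤ i → i ≤ k → dCubeSide (F.P K).L M (RkOfRecord (F.P K).L ν.r (g i)) i ∣ (F.P K).sitesPerDir 0) B₃ B₉ a₀ a₁')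
    (h3A'G : ∀ (F : T4Family) (j c c₀ c₁ : ℕ) (B₃ B₃' a₀ a₁ : ℝ), c ≤ F.L ^ j → c₀ ≤ j + 1 → c₁ ≤ j → 2 * (F.L : ℝ) ^ 2 ≤ B₃ → 0 < B₃' → 0 < a₀ → 0 < a₁ →
      VariationalThm1RegSepCoP7MG F 2 (fun ν M g K k _s => c ≤ ν.M₁ ∧ k + c₀ ≤ F.m + K ∧ F.L ^ c₁ ∣ M ∧
      ∀ i, 1 ≤ i → i ≤ k → dCubeSide (F.P K).L M (RkOfRecord (F.P K).L ν.r (g i)) i ∣ (F.P K).sitesPerDir 0) B₃ a₀ a₁ →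
      Gauge9RegSepTopStepG F 2 (fun ν K Ω => suppDomOfRecord F ν K Ω) (F.L ^ j) (fun ν M g K k _s => c ≤ ν.M₁ ∧ k + c₀ ≤ F.m + K ∧ F.L ^ c₁ ∣ M ∧
      ∀ i, 1 ≤ i → i ≤ k → dCubeSide (F.P K).L M (RkOfRecord (F.P K).L ν.r (g i)) i ∣ (F.P K).sitesPerDir 0) B₃ B₃' a₀ a₁ →
      ∃ γ₀ ε₀ ε₂₉ β' : ℝ, 0 < γ₀ ∧ 0 < ε₀ ∧ 0 < ε₂₉ ∧
        BetaLowerH (-β') γ₀ (betaOfRecord₁₃ F 2 (theta13OfThm1CCM F 2 j ε₀ ε₂₉ B₃ B₃' a₀ a₁)) ∧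
        BetaUpperH β' γ₀ (betaOfRecord₁₃ F 2 (theta13OfThm1CCM F 2 j ε₀ ε₂₉ B₃ B₃' a₀ a₁))) :
    ∀ F : T4Family, ∃ θ : Stage13HParams F 2, θ.Provisos₁₃SepCoPH F 2 ∧ (θ.ZhUnity F 2 ∧ θ.SlotsNondegenerate₁₃ F 2) ∧ θ.Admissible F 2 := by
  intro F
  obtain ⟨c, c₀, c₁, B₃, a₀, a₁, hB₃, ha₀, ha₁, h8⟩ := h1G F
  have hL : (0 : ℝ) < (F.L : ℝ) := by exact_mod_cast lt_trans Nat.zero_lt_one F.hL.2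
  have hBpos : (0 : ℝ) < B₃ := lt_of_lt_of_le (mul_pos two_pos (pow_pos hL 2)) hB₃
  obtain ⟨j, c', B₉, a₁', hcc', hc', hc₀, hc₁, hB₉, ha₁', ha₁'le, h9⟩ := hSG F c c₀ c₁ B₃ a₀ a₁ hB₃ ha₀ ha₁ h8
  have h15 : VariationalThm1RegSepCoP7MG F 2 (fun ν M g K k _s => c' ≤ ν.M₁ ∧ k + c₀ ≤ F.m + K ∧ F.L ^ c₁ ∣ M ∧
      ∀ i, 1 ≤ i → i ≤ k → dCubeSide (F.P K).L M (RkOfRecord (F.P K).L ν.r (g i)) i ∣ (F.P K).sitesPerDir 0) B₃ a₀ a₁' :=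
    (variationalThm1RegSepCoP7MG_of_prop8TopStepG hBpos (h8.of_le le_rfl ha₁'le)).of_imp fun _ _ _ _ _ _ h => ⟨hcc'.trans h.1, h.2⟩
  exact exists_k0H_of_thm1CoP7MG3_of_gauge9G3_of_absBox F hc' hc₀ hc₁ hBpos.le hB₉.le ha₀ ha₁' h15 h9
    (h3A'G F j c' c₀ c₁ B₃ B₉ a₀ a₁' hc' hc₀ hc₁ hB₃ hB₉ ha₀ ha₁' h15 h9)

/-- **NODE O's JETS-FREE PAIR AT A1's WITNESS `θ₁₅ᶜᶜᴹ(j)` SUPPLIES THE CANDIDATE 3ᴬ′-G‴ AT THE CUBE LETTER `(j, c, c₀, c₁)`** — p635083 §4's `absBetaBoxAtG_of_jetsFreePairAtG` with both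
antecedents under `A‴`; N26's `exists_betaBox_betaOfRecord₁₃_of_jetsFreePair` is θ-generic, so the proof is the same three lines.  CONDITIONAL on the pair; NOT proved; nothing asserted.
[cite: Balaban1987RG1, Thm 2 p.259, §1 p.264, (2.12)–(2.14) p.268, (5.10) p.293; Balaban1988RG2Cluster, Lemma 3 (2.38) p.20; Balaban1985Variational, Thm 1 p.279, Prop. 8 p.304, p.304 lines 1–2] -/
theorem absBetaBoxAtG3_of_jetsFreePairAtG3 (F : T4Family) (j c c₀ c₁ : ℕ)
    (h : ∀ B₃ B₃' a₀ a₁ : ℝ, 2 * (F.L : ℝ) ^ 2 ≤ B₃ → 0 < B₃' → 0 < a₀ → 0 < a₁ →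
      VariationalThm1RegSepCoP7MG F 2 (fun ν M g K k _s => c ≤ ν.M₁ ∧ k + c₀ ≤ F.m + K ∧ F.L ^ c₁ ∣ M ∧
      ∀ i, 1 ≤ i → i ≤ k → dCubeSide (F.P K).L M (RkOfRecord (F.P K).L ν.r (g i)) i ∣ (F.P K).sitesPerDir 0) B₃ a₀ a₁ →
      Gauge9RegSepTopStepG F 2 (fun ν K Ω => suppDomOfRecord F ν K Ω) (F.L ^ j) (fun ν M g K k _s => c ≤ ν.M₁ ∧ k + c₀ ≤ F.m + K ∧ F.L ^ c₁ ∣ M ∧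
      ∀ i, 1 ≤ i → i ≤ k → dCubeSide (F.P K).L M (RkOfRecord (F.P K).L ν.r (g i)) i ∣ (F.P K).sitesPerDir 0) B₃ B₃' a₀ a₁ →
      ∃ ε₀ ε₂₉ : ℝ, 0 < ε₀ ∧ 0 < ε₂₉ ∧
        (letI := (theta13OfThm1CCM F 2 j ε₀ ε₂₉ B₃ B₃' a₀ a₁).instVβ₁; letI := (theta13OfThm1CCM F 2 j ε₀ ε₂₉ B₃ B₃' a₀ a₁).instVβ₂;
         letI := (theta13OfThm1CCM F 2 j ε₀ ε₂₉ B₃ B₃' a₀ a₁).instιβ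
         ∃ d A : ℝ, 0 ≤ d ∧
           OneLoopDrift d A (beta0OfMerged (betaMerged F (mergedTermFamilyMatT F 2 (TcanOfRecord F 2)
             (chiFixed29 F 2 (theta13OfThm1CCM F 2 j ε₀ ε₂₉ B₃ B₃' a₀ a₁).ν (theta13OfThm1CCM F 2 j ε₀ ε₂₉ B₃ B₃' a₀ a₁).ε₂₉) (theta13OfThm1CCM F 2 j ε₀ ε₂₉ B₃ B₃' a₀ a₁).εbg)
             (theta13OfThm1CCM F 2 j ε₀ ε₂₉ B₃ B₃' a₀ a₁).ρ8 (theta13OfThm1CCM F 2 j ε₀ ε₂₉ B₃ B₃' a₀ a₁).bV) (theta13OfThm1CCM F 2 j ε₀ ε₂₉ B₃ B₃' a₀ a₁).v₀) ∧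
           ∃ γ₀ : ℝ, 0 < γ₀ ∧ γ₀ ≤ (theta13OfThm1CCM F 2 j ε₀ ε₂₉ B₃ B₃' a₀ a₁).γ ∧
             AtSlopeCont
               (oneLoopSplit_betaOfMerged
                 (betaMerged F (mergedTermFamilyMatT F 2 (TcanOfRecord F 2)
                   (chiFixed29 F 2 (theta13OfThm1CCM F 2 j ε₀ ε₂₉ B₃ B₃' a₀ a₁).ν (theta13OfThm1CCM F 2 j ε₀ ε₂₉ B₃ B₃' a₀ a₁).ε₂₉) (theta13OfThm1CCM F 2 j ε₀ ε₂₉ B₃ B₃' a₀ a₁).εbg)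
                   (theta13OfThm1CCM F 2 j ε₀ ε₂₉ B₃ B₃' a₀ a₁).ρ8 (theta13OfThm1CCM F 2 j ε₀ ε₂₉ B₃ B₃' a₀ a₁).bV)
                 (beta0OfMerged (betaMerged F (mergedTermFamilyMatT F 2 (TcanOfRecord F 2)
                   (chiFixed29 F 2 (theta13OfThm1CCM F 2 j ε₀ ε₂₉ B₃ B₃' a₀ a₁).ν (theta13OfThm1CCM F 2 j ε₀ ε₂₉ B₃ B₃' a₀ a₁).ε₂₉) (theta13OfThm1CCM F 2 j ε₀ ε₂₉ B₃ B₃' a₀ a₁).εbg)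
                   (theta13OfThm1CCM F 2 j ε₀ ε₂₉ B₃ B₃' a₀ a₁).ρ8 (theta13OfThm1CCM F 2 j ε₀ ε₂₉ B₃ B₃' a₀ a₁).bV) (theta13OfThm1CCM F 2 j ε₀ ε₂₉ B₃ B₃' a₀ a₁).v₀)
                 (theta13OfThm1CCM F 2 j ε₀ ε₂₉ B₃ B₃' a₀ a₁).γ)
               γ₀ d)) :
    ∀ B₃ B₃' a₀ a₁ : ℝ, 2 * (F.L : ℝ) ^ 2 ≤ B₃ → 0 < B₃' → 0 < a₀ → 0 < a₁ →
      VariationalThm1RegSepCoP7MG F 2 (fun ν M g K k _s => c ≤ ν.M₁ ∧ k + c₀ ≤ F.m + K ∧ F.L ^ c₁ ∣ M ∧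
      ∀ i, 1 ≤ i → i ≤ k → dCubeSide (F.P K).L M (RkOfRecord (F.P K).L ν.r (g i)) i ∣ (F.P K).sitesPerDir 0) B₃ a₀ a₁ →
      Gauge9RegSepTopStepG F 2 (fun ν K Ω => suppDomOfRecord F ν K Ω) (F.L ^ j) (fun ν M g K k _s => c ≤ ν.M₁ ∧ k + c₀ ≤ F.m + K ∧ F.L ^ c₁ ∣ M ∧
      ∀ i, 1 ≤ i → i ≤ k → dCubeSide (F.P K).L M (RkOfRecord (F.P K).L ν.r (g i)) i ∣ (F.P K).sitesPerDir 0) B₃ B₃' a₀ a₁ →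
      ∃ γ₀ ε₀ ε₂₉ β' : ℝ, 0 < γ₀ ∧ 0 < ε₀ ∧ 0 < ε₂₉ ∧
        BetaLowerH (-β') γ₀ (betaOfRecord₁₃ F 2 (theta13OfThm1CCM F 2 j ε₀ ε₂₉ B₃ B₃' a₀ a₁)) ∧
        BetaUpperH β' γ₀ (betaOfRecord₁₃ F 2 (theta13OfThm1CCM F 2 j ε₀ ε₂₉ B₃ B₃' a₀ a₁)) := by
  intro B₃ B₃' a₀ a₁ hB₃ hB₃' ha₀ ha₁ h15 h9
  obtain ⟨ε₀, ε₂₉, hε, hε', hJ⟩ := h B₃ B₃' a₀ a₁ hB₃ hB₃' ha₀ ha₁ h15 h9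
  obtain ⟨γ₀, hγ0, -, β', -, hup, hlow, -⟩ := exists_betaBox_betaOfRecord₁₃_of_jetsFreePair F 2 (theta13OfThm1CCM F 2 j ε₀ ε₂₉ B₃ B₃' a₀ a₁) hJ
  exact ⟨γ₀, ε₀, ε₂₉, β', hγ0, hε, hε', hlow, hup⟩

end Part1GridGuarded

/-! ## §2  PART 2-G‴: stub 2′ fills the (9)-supplier slot under `A‴`; ★★★ the V21-G candidate composition -/

section Part2GridGuarded

variable (F : T4Family)

/-- **★★ STUB 2′ AT `F` FILLS PART 1-G‴'s (9)-SUPPLIER SLOT UNDER `A‴`** — p635645 §1 with the guard `A‴(c, c₀, c₁)`: dag-n07-e module 51 `gauge9GP_of_prop8TopStepG_of_prop6P_of_one_le` BY NAME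
at `M := L^j`, `j := ρ₀ + 3 + c + c₀ + c₁` (so `c ≤ c′ ≤ L^j`, `c₀ ≤ j + 1`, `c₁ ≤ j`), its output guard `A‴ ⊓ floor c(ρ₀)` refined to `A‴(c′, c₀, c₁)`, `c′ := max c ((11·4 + 4ρ₀L)·L)`, by `.of_imp`;
`B₉ = b9OfP·B₃`, ceiling `a₁′ = min a₁ (a0OfP∕B₃)`.  CONDITIONAL. [cite: Balaban1985Variational, Thm 1 (8)–(10) p.279, (144)–(152) pp.300–301, Prop. 8 p.304, p.304 lines 1–2; Balaban1985RegularSpaces, Prop. 6 p.99, p.98; Balaban1988Convergent, (2.1) p.254, (2.5) p.255; Balaban1987RG1, (0.1) p.251] -/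
theorem gauge9SupplierG3_of_prop6MemberP
    (h2P : ∃ (ρ₀ : ℕ) (B₁ cP : ℝ), 1 ≤ ρ₀ ∧ 0 ≤ B₁ ∧ 0 < cP ∧
      (letI : CStarAlgebra (MatA 2) := {}; B8.Prop6Printed 4 (F.L : ℝ) B₁ cP (fun i : ZdIdx 4 F.L => zdCubP (MatA 2) F.L ρ₀ i)))
    (c c₀ c₁ : ℕ) (B₃ a₀ a₁ : ℝ) (hB₃ : 2 * (F.L : ℝ) ^ 2 ≤ B₃) (_ha₀ : 0 < a₀) (ha₁ : 0 < a₁)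
    (h8 : Prop8RegSepTopStepG F 2 (fun ν K Ω => suppDomOfRecord F ν K Ω) (fun ν M g K k _s => c ≤ ν.M₁ ∧ k + c₀ ≤ F.m + K ∧ F.L ^ c₁ ∣ M ∧
      ∀ i, 1 ≤ i → i ≤ k → dCubeSide (F.P K).L M (RkOfRecord (F.P K).L ν.r (g i)) i ∣ (F.P K).sitesPerDir 0) B₃ a₀ a₁) :
    ∃ (j c' : ℕ) (B₉ a₁' : ℝ), c ≤ c' ∧ c' ≤ F.L ^ j ∧ c₀ ≤ j + 1 ∧ c₁ ≤ j ∧ 0 < B₉ ∧ 0 < a₁' ∧ a₁' ≤ a₁ ∧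
      Gauge9RegSepTopStepG F 2 (fun ν K Ω => suppDomOfRecord F ν K Ω) (F.L ^ j) (fun ν M g K k _s => c' ≤ ν.M₁ ∧ k + c₀ ≤ F.m + K ∧ F.L ^ c₁ ∣ M ∧
      ∀ i, 1 ≤ i → i ≤ k → dCubeSide (F.P K).L M (RkOfRecord (F.P K).L ν.r (g i)) i ∣ (F.P K).sitesPerDir 0) B₃ B₉ a₀ a₁' := by
  obtain ⟨ρ₀, B₁, cP, hρ₀, hB₁, hcP, hP6⟩ := h2P
  have hL : (0 : ℝ) < (F.L : ℝ) := by exact_mod_cast lt_trans Nat.zero_lt_one F.hL.2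
  have hBpos : (0 : ℝ) < B₃ := lt_of_lt_of_le (mul_pos two_pos (pow_pos hL 2)) hB₃
  set M : ℕ := F.L ^ (ρ₀ + 3 + c + c₀ + c₁) with hM
  have ha0P : 0 < a0OfP F 2 M (ρ₀ * F.L) B₁ cP := a0OfP_pos (F := F) (N := 2) M (ρ₀ * F.L) hB₁ hcP
  have ha₁' : 0 < min a₁ (a0OfP F 2 M (ρ₀ * F.L) B₁ cP / B₃) := lt_min ha₁ (div_pos ha0P hBpos)
  have hle : B₃ * min a₁ (a0OfP F 2 M (ρ₀ * F.L) B₁ cP / B₃) ≤ a0OfP F 2 M (ρ₀ * F.L) B₁ cP :=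
    calc B₃ * min a₁ (a0OfP F 2 M (ρ₀ * F.L) B₁ cP / B₃) ≤ B₃ * (a0OfP F 2 M (ρ₀ * F.L) B₁ cP / B₃) :=
          mul_le_mul_of_nonneg_left (min_le_right _ _) hBpos.le
      _ = a0OfP F 2 M (ρ₀ * F.L) B₁ cP := mul_div_cancel₀ _ hBpos.ne'
  have hL0 : 0 < F.L := by have := F.hL.2; omega
  have hfloor : max c ((11 * 4 + 4 * (ρ₀ * F.L)) * F.L) ≤ F.L ^ (ρ₀ + 3 + c + c₀ + c₁) :=
    (max_floor_le_pow F hρ₀ c).trans (Nat.pow_le_pow_right hL0 (by omega))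
  exact ⟨ρ₀ + 3 + c + c₀ + c₁, max c ((11 * 4 + 4 * (ρ₀ * F.L)) * F.L), b9OfP F M (ρ₀ * F.L) B₁ * B₃, min a₁ (a0OfP F 2 M (ρ₀ * F.L) B₁ cP / B₃),
    le_max_left _ _, hfloor, by omega, by omega, mul_pos (b9OfP_pos (F := F) M (ρ₀ * F.L) hB₁) hBpos, ha₁', min_le_left _ _,
    (gauge9GP_of_prop8TopStepG_of_prop6P_of_one_le (h8.of_le le_rfl (min_le_left _ _)) hB₁ hcP hρ₀ hP6 M hBpos hle).of_imp
      fun _ _ _ _ _ _ h => ⟨⟨(le_max_left _ _).trans h.1, h.2⟩, (le_max_right _ _).trans h.1⟩⟩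

end Part2GridGuarded

section CompositionGridGuarded

/-- **★★★ K0⁷'s BODY AT EVERY FAMILY FROM THE CANDIDATE STUB 1-G‴, STUB 2′ AND THE CANDIDATE 3ᴬ′-G‴** — `h1G3` = the V21-G candidate stub-1 text ([15] Prop. 8's top step at the
record's support selector under `A‴(c, c₀, c₁)` for SOME `(c, c₀, c₁)` and guarded `(B₃, a₀, a₁)`); `h2P` = STUB 2′ VERBATIM (landed p595104); `h3A'G3` = the 3ᴬ′-G‴ candidate (binders
`(j c c₀ c₁)`, riders `c₀ ≤ j + 1`, `c₁ ≤ j`, both antecedents under `A‴`).  Proof: §2's supplier, then §1.  The shape a V21-G skeleton's `Record13SepCoPHInhabited_of h1G h2P h3A'G` would cite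
BY NAME.  CONDITIONAL; the texts are CANDIDATES, NOT registered; K0⁷ NOT closed; nothing of Bałaban asserted; a re-text is not progress.
[cite: Balaban1985Variational, Thm 1 (8)–(9) p.279, (144)–(152) pp.300–301, Prop. 8 p.304, p.304 lines 1–2; Balaban1985RegularSpaces, (1.3)–(1.6) p.77, Prop. 6 p.99, p.98; Balaban1988Convergent, Thm 1 p.262, (2.1) p.254, (2.5)–(2.8) pp.255–256, p.257; Balaban1987RG1, Thm 1 p.259, (0.1) p.251, §1 p.264] -/
theorem record13SepCoPHBody_of_stubs1G3_2P_3A'G3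
    (h1G : ∀ F : T4Family, ∃ (c c₀ c₁ : ℕ) (B₃ a₀ a₁ : ℝ), 2 * (F.L : ℝ) ^ 2 ≤ B₃ ∧ 0 < a₀ ∧ 0 < a₁ ∧
      Prop8RegSepTopStepG F 2 (fun ν K Ω => suppDomOfRecord F ν K Ω) (fun ν M g K k _s => c ≤ ν.M₁ ∧ k + c₀ ≤ F.m + K ∧ F.L ^ c₁ ∣ M ∧
      ∀ i, 1 ≤ i → i ≤ k → dCubeSide (F.P K).L M (RkOfRecord (F.P K).L ν.r (g i)) i ∣ (F.P K).sitesPerDir 0) B₃ a₀ a₁)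
    (h2P : ∀ F : T4Family, ∃ (ρ₀ : ℕ) (B₁ c₁ : ℝ), 1 ≤ ρ₀ ∧ 0 ≤ B₁ ∧ 0 < c₁ ∧
      (letI : CStarAlgebra (MatA 2) := {}; B8.Prop6Printed 4 (F.L : ℝ) B₁ c₁ (fun i : ZdIdx 4 F.L => zdCubP (MatA 2) F.L ρ₀ i)))
    (h3A'G : ∀ (F : T4Family) (j c c₀ c₁ : ℕ) (B₃ B₃' a₀ a₁ : ℝ), c ≤ F.L ^ j → c₀ ≤ j + 1 → c₁ ≤ j → 2 * (F.L : ℝ) ^ 2 ≤ B₃ → 0 < B₃' → 0 < a₀ → 0 < a₁ →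
      VariationalThm1RegSepCoP7MG F 2 (fun ν M g K k _s => c ≤ ν.M₁ ∧ k + c₀ ≤ F.m + K ∧ F.L ^ c₁ ∣ M ∧
      ∀ i, 1 ≤ i → i ≤ k → dCubeSide (F.P K).L M (RkOfRecord (F.P K).L ν.r (g i)) i ∣ (F.P K).sitesPerDir 0) B₃ a₀ a₁ →
      Gauge9RegSepTopStepG F 2 (fun ν K Ω => suppDomOfRecord F ν K Ω) (F.L ^ j) (fun ν M g K k _s => c ≤ ν.M₁ ∧ k + c₀ ≤ F.m + K ∧ F.L ^ c₁ ∣ M ∧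
      ∀ i, 1 ≤ i → i ≤ k → dCubeSide (F.P K).L M (RkOfRecord (F.P K).L ν.r (g i)) i ∣ (F.P K).sitesPerDir 0) B₃ B₃' a₀ a₁ →
      ∃ γ₀ ε₀ ε₂₉ β' : ℝ, 0 < γ₀ ∧ 0 < ε₀ ∧ 0 < ε₂₉ ∧
        BetaLowerH (-β') γ₀ (betaOfRecord₁₃ F 2 (theta13OfThm1CCM F 2 j ε₀ ε₂₉ B₃ B₃' a₀ a₁)) ∧
        BetaUpperH β' γ₀ (betaOfRecord₁₃ F 2 (theta13OfThm1CCM F 2 j ε₀ ε₂₉ B₃ B₃' a₀ a₁))) :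
    ∀ F : T4Family, ∃ θ : Stage13HParams F 2, θ.Provisos₁₃SepCoPH F 2 ∧ (θ.ZhUnity F 2 ∧ θ.SlotsNondegenerate₁₃ F 2) ∧ θ.Admissible F 2 :=
  record13SepCoPHBody_of_stub1G3_of_gauge9SupplierG3_of_absBetaBoxAtG3 h1G
    (fun F c c₀ c₁ B₃ a₀ a₁ hB₃ ha₀ ha₁ h8 => gauge9SupplierG3_of_prop6MemberP F (h2P F) c c₀ c₁ B₃ a₀ a₁ hB₃ ha₀ ha₁ h8) h3A'G

end CompositionGridGuarded

/-! ## §3  The directions (kernel): stub 1 G ⟹ G‴ (antitone; in-flight G filings stay usable), 3ᴬ′ G‴ ⟹ G -/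

section Direction

/-- **V20-G's STUB 1 ⟹ THE CANDIDATE STUB 1-G‴ AT `F`** (`c₁ := 0`; the step token is ANTITONE in the guard, module 47 `Prop8RegSepTopStepG.of_imp`): a by-name proof of the REGISTERED
V20-G stub 1 (hence of V20-R's or V19's, through p635083 §5 ∕ p630016) lands on the G‴ text by one line; never conversely.
[cite: Balaban1985Variational, Prop. 8 p.304, p.304 lines 1–2 (bookkeeping); Balaban1985RegularSpaces, (1.3)–(1.6) p.77; Balaban1988Convergent, (2.1) p.254; Balaban1987RG1, (0.1) p.251] -/
theorem prop8StepCoPG3_of_prop8StepCoPG (F : T4Family)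
    (h1G : ∃ (c c₀ : ℕ) (B₃ a₀ a₁ : ℝ), 2 * (F.L : ℝ) ^ 2 ≤ B₃ ∧ 0 < a₀ ∧ 0 < a₁ ∧
      Prop8RegSepTopStepG F 2 (fun ν K Ω => suppDomOfRecord F ν K Ω) (fun ν _M _g K k _s => c ≤ ν.M₁ ∧ k + c₀ ≤ F.m + K) B₃ a₀ a₁) :
    ∃ (c c₀ c₁ : ℕ) (B₃ a₀ a₁ : ℝ), 2 * (F.L : ℝ) ^ 2 ≤ B₃ ∧ 0 < a₀ ∧ 0 < a₁ ∧
      Prop8RegSepTopStepG F 2 (fun ν K Ω => suppDomOfRecord F ν K Ω) (fun ν M g K k _s => c ≤ ν.M₁ ∧ k + c₀ ≤ F.m + K ∧ F.L ^ c₁ ∣ M ∧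
      ∀ i, 1 ≤ i → i ≤ k → dCubeSide (F.P K).L M (RkOfRecord (F.P K).L ν.r (g i)) i ∣ (F.P K).sitesPerDir 0) B₃ a₀ a₁ := by
  obtain ⟨c, c₀, B₃, a₀, a₁, hB₃, ha₀, ha₁, h8⟩ := h1G
  exact ⟨c, c₀, 0, B₃, a₀, a₁, hB₃, ha₀, ha₁, h8.of_imp fun _ _ _ _ _ _ h => ⟨h.1, h.2.1⟩⟩

/-- **THE CANDIDATE 3ᴬ′-G‴ ⟹ V20-G's 3ᴬ′ AT `F`** (at `c₁ := 0 ≤ j`: the G antecedents give the G‴ ones by antitonicity — module 49 `VariationalThm1RegSepCoP7MG.of_imp`, module 51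
`Gauge9RegSepTopStepG.of_imp`): the chain of stub-3 texts reads G‴ ⟹ G ⟹ R ⟹ V19 — G‴ is the STRONGEST (honest display; NODE O reads the sentences, if at all, at the witness's own
guarded, torus-compatible runs, where all four conjuncts hold — §1's socket).
[cite: Balaban1987RG1, §1 p.264 (bookkeeping); Balaban1985Variational, Thm 1 (8)–(9) p.279, p.304 lines 1–2; Balaban1988Convergent, (2.1) p.254, p.257] -/
theorem absBetaBoxAtGenG_of_absBetaBoxAtGenG3 (F : T4Family)
    (h3A'G3 : ∀ (j c c₀ c₁ : ℕ) (B₃ B₃' a₀ a₁ : ℝ), c ≤ F.L ^ j → c₀ ≤ j + 1 → c₁ ≤ j → 2 * (F.L : ℝ) ^ 2 ≤ B₃ → 0 < B₃' → 0 < a₀ → 0 < a₁ →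
      VariationalThm1RegSepCoP7MG F 2 (fun ν M g K k _s => c ≤ ν.M₁ ∧ k + c₀ ≤ F.m + K ∧ F.L ^ c₁ ∣ M ∧
      ∀ i, 1 ≤ i → i ≤ k → dCubeSide (F.P K).L M (RkOfRecord (F.P K).L ν.r (g i)) i ∣ (F.P K).sitesPerDir 0) B₃ a₀ a₁ →
      Gauge9RegSepTopStepG F 2 (fun ν K Ω => suppDomOfRecord F ν K Ω) (F.L ^ j) (fun ν M g K k _s => c ≤ ν.M₁ ∧ k + c₀ ≤ F.m + K ∧ F.L ^ c₁ ∣ M ∧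
      ∀ i, 1 ≤ i → i ≤ k → dCubeSide (F.P K).L M (RkOfRecord (F.P K).L ν.r (g i)) i ∣ (F.P K).sitesPerDir 0) B₃ B₃' a₀ a₁ →
      ∃ γ₀ ε₀ ε₂₉ β' : ℝ, 0 < γ₀ ∧ 0 < ε₀ ∧ 0 < ε₂₉ ∧
        BetaLowerH (-β') γ₀ (betaOfRecord₁₃ F 2 (theta13OfThm1CCM F 2 j ε₀ ε₂₉ B₃ B₃' a₀ a₁)) ∧
        BetaUpperH β' γ₀ (betaOfRecord₁₃ F 2 (theta13OfThm1CCM F 2 j ε₀ ε₂₉ B₃ B₃' a₀ a₁))) :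
    ∀ (j c c₀ : ℕ) (B₃ B₃' a₀ a₁ : ℝ), c ≤ F.L ^ j → c₀ ≤ j + 1 → 2 * (F.L : ℝ) ^ 2 ≤ B₃ → 0 < B₃' → 0 < a₀ → 0 < a₁ →
      VariationalThm1RegSepCoP7MG F 2 (fun ν _M _g K k _s => c ≤ ν.M₁ ∧ k + c₀ ≤ F.m + K) B₃ a₀ a₁ →
      Gauge9RegSepTopStepG F 2 (fun ν K Ω => suppDomOfRecord F ν K Ω) (F.L ^ j) (fun ν _M _g K k _s => c ≤ ν.M₁ ∧ k + c₀ ≤ F.m + K) B₃ B₃' a₀ a₁ →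
      ∃ γ₀ ε₀ ε₂₉ β' : ℝ, 0 < γ₀ ∧ 0 < ε₀ ∧ 0 < ε₂₉ ∧
        BetaLowerH (-β') γ₀ (betaOfRecord₁₃ F 2 (theta13OfThm1CCM F 2 j ε₀ ε₂₉ B₃ B₃' a₀ a₁)) ∧
        BetaUpperH β' γ₀ (betaOfRecord₁₃ F 2 (theta13OfThm1CCM F 2 j ε₀ ε₂₉ B₃ B₃' a₀ a₁)) :=
  fun j c c₀ B₃ B₃' a₀ a₁ hc hc₀ hB₃ hB₃' ha₀ ha₁ h15 h9 =>
    h3A'G3 j c c₀ 0 B₃ B₃' a₀ a₁ hc hc₀ (Nat.zero_le _) hB₃ hB₃' ha₀ ha₁ (h15.of_imp fun _ _ _ _ _ _ h => ⟨h.1, h.2.1⟩)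
      (h9.of_imp fun _ _ _ _ _ _ h => ⟨h.1, h.2.1⟩)

/-- **SANITY: V20-G's REGISTERED STUB 1 ∧ STUB 2′ ∧ THE CANDIDATE 3ᴬ′-G‴ ⟹ K0⁷'s BODY** (G ⟹ G‴ on stub 1, then §2) — an in-flight by-name proof of `stub_prop8StepCoPG13` (V20-G) feeds the
V21-G composition unchanged.  CONDITIONAL; displayed, not a registration. [cite: Balaban1985Variational, Prop. 8 p.304, p.304 lines 1–2 (bookkeeping); Balaban1985RegularSpaces, Prop. 6 p.99; Balaban1987RG1, §1 p.264] -/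
theorem record13SepCoPHBody_of_stubs1G_2P_3A'G3
    (h1G : ∀ F : T4Family, ∃ (c c₀ : ℕ) (B₃ a₀ a₁ : ℝ), 2 * (F.L : ℝ) ^ 2 ≤ B₃ ∧ 0 < a₀ ∧ 0 < a₁ ∧
      Prop8RegSepTopStepG F 2 (fun ν K Ω => suppDomOfRecord F ν K Ω) (fun ν _M _g K k _s => c ≤ ν.M₁ ∧ k + c₀ ≤ F.m + K) B₃ a₀ a₁)
    (h2P : ∀ F : T4Family, ∃ (ρ₀ : ℕ) (B₁ cP : ℝ), 1 ≤ ρ₀ ∧ 0 ≤ B₁ ∧ 0 < cP ∧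
      (letI : CStarAlgebra (MatA 2) := {}; B8.Prop6Printed 4 (F.L : ℝ) B₁ cP (fun i : ZdIdx 4 F.L => zdCubP (MatA 2) F.L ρ₀ i)))
    (h3A'G3 : ∀ (F : T4Family) (j c c₀ c₁ : ℕ) (B₃ B₃' a₀ a₁ : ℝ), c ≤ F.L ^ j → c₀ ≤ j + 1 → c₁ ≤ j → 2 * (F.L : ℝ) ^ 2 ≤ B₃ → 0 < B₃' → 0 < a₀ → 0 < a₁ →
      VariationalThm1RegSepCoP7MG F 2 (fun ν M g K k _s => c ≤ ν.M₁ ∧ k + c₀ ≤ F.m + K ∧ F.L ^ c₁ ∣ M ∧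
      ∀ i, 1 ≤ i → i ≤ k → dCubeSide (F.P K).L M (RkOfRecord (F.P K).L ν.r (g i)) i ∣ (F.P K).sitesPerDir 0) B₃ a₀ a₁ →
      Gauge9RegSepTopStepG F 2 (fun ν K Ω => suppDomOfRecord F ν K Ω) (F.L ^ j) (fun ν M g K k _s => c ≤ ν.M₁ ∧ k + c₀ ≤ F.m + K ∧ F.L ^ c₁ ∣ M ∧
      ∀ i, 1 ≤ i → i ≤ k → dCubeSide (F.P K).L M (RkOfRecord (F.P K).L ν.r (g i)) i ∣ (F.P K).sitesPerDir 0) B₃ B₃' a₀ a₁ →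
      ∃ γ₀ ε₀ ε₂₉ β' : ℝ, 0 < γ₀ ∧ 0 < ε₀ ∧ 0 < ε₂₉ ∧
        BetaLowerH (-β') γ₀ (betaOfRecord₁₃ F 2 (theta13OfThm1CCM F 2 j ε₀ ε₂₉ B₃ B₃' a₀ a₁)) ∧
        BetaUpperH β' γ₀ (betaOfRecord₁₃ F 2 (theta13OfThm1CCM F 2 j ε₀ ε₂₉ B₃ B₃' a₀ a₁))) :
    ∀ F : T4Family, ∃ θ : Stage13HParams F 2, θ.Provisos₁₃SepCoPH F 2 ∧ (θ.ZhUnity F 2 ∧ θ.SlotsNondegenerate₁₃ F 2) ∧ θ.Admissible F 2 :=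
  record13SepCoPHBody_of_stubs1G3_2P_3A'G3 (fun F => prop8StepCoPG3_of_prop8StepCoPG F (h1G F)) h2P h3A'G3

end Direction

end Summit.QuantumFields.YangMills.Theorems.K0PrintCubeOfStepTokensGridGuarded

end
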